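import Literature.Probability.RandomPlanarGeometry.HexSAWArmchairSlabWallBridges
import HarnessLib

/-!
# Beaton's strips of the rotated honeycomb lattice: `μ_H(y) ≤ max(β_rot(y), μ)` given the unfolding face, and the locality
# `μ_H(y) → β_rot(y)` (`H → ∞`) for EVERY `y > 0` once `μ ≤ β_rot(y)`

Topic `Literature/Probability/RandomPlanarGeometry` (lane «pcv-sawmu», door «HEX-YC-ROT-LIMIT-ALL-Y», rider I' «ROT-SLAB-LOCALITY»;
continues `HexSAWArmchairSlabWallBridges.lean` — `eventually_le_slabMuY : r < β_rot(y) ⇒ r ≤ μ_H(y)` eventually — with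
`HexSAWArmchairWallBridges.lean` (`Cw`, `ArchBound`, `Cw_le_of_archBound`, `exists_hexSawCount_le_pow`) and
`HexSAWBrickWallSlabFugacity.lean` (`slabZ`, `slabSplit`, `leftVisits_split`, `slabMuY_le_rpow`, `tendsto_slabZ_rpow`)).

Source.  N. R. Beaton, J. Phys. A 47 (2014) 075003, arXiv:1210.0274v3, §3.2, Proposition 9 (p. 15): "Moreover, as `T → ∞`,
`μ_T(1,y) → μ(y)`, where `μ(y)` is as defined in Proposition 7."  ("The proof is virtually identical to that of Proposition 7 in
[BBdGDCG14]": a walk of the strip is a walk of the half-plane, so `μ_T ≤ μ(y)`; the other direction is the concatenation of unfolded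
walks of a fixed length inside the strip, `HexSAWArmchairSlabWallBridges.lean`.)  N. R. Beaton, M. Bousquet-Mélou, J. de Gier,
H. Duminil-Copin, A. J. Guttmann, CMP 326 (2014) 727, Proposition 7 and its proof.

## The argument for the upper bound (armchair frame; the surface weight sits on the column `x₀ = 0`)

Split a walk of `Slab_H` (start anywhere in the cross-section) at its FIRST vertex in the column `0`: the prefix is a walk of
`Slab_H` carrying no weight except that vertex, the suffix is a walk of `Slab_H` STARTING in the column `0` and carrying the whole
weight; re-based at `0` with the parity twist it is a `C`-class walk of the half-plane with the same number of wall visits.  Hence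
`Ĉ_{H,N}(y) ≤ c_N(Slab_H) + Σ_{k ≤ N} c_k(Slab_H) · 2 C^w_{N−k}(y)`, and with `c_k(Slab_H) ≤ 2(H+1) c_k(ℍ) ≤ 2(H+1) C₂ rᵏ` and
`C^w_m(y) ≤ C₁ (m+1) rᵐ` (`r > max(β_rot(y), μ)`, the face `ArchBound y`): `Ĉ_{H,N}(y) ≤ K (N+1)² r^N`, so `μ_H(y) ≤ r`.

## Main statements (namespace `…SAW.HexBW.Arm`, all PROVED)

* `leftVisits_eq_visits_twist`, `sum_wallStart_le` — `Σ_{walks of Slab_H from the column 0} y^{visits} ≤ 2 C^w_m(y)`;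
* `fvisit` (first column-`0` time), **`slabZ_le_sum`** — the first-visit split;
* **`slabMuY_le_of_archBound (hy : 0 < y) (hA : ArchBound y) (hH : 1 ≤ H) : slabMuY H y ≤ max (armRate y) hexConnectiveConstant`**;
* **`tendsto_slabMuY_of_archBound`** — `ArchBound y → μ ≤ β_rot(y) → μ_H(y) → β_rot(y)`: Beaton's Proposition 9, second sentence,
  for every `y > 0`, modulo the two inputs discharged by `HexSAWArmchairUnfolding.lean` and `HexSAWArmchairWallBridgeRate.lean`.
-/

noncomputable section

open Finset Filter Function
open Literature.Probability.LatticeModels Literature.Probability.Percolation SimpleGraph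
open _root_.Topology

namespace Literature.Probability.RandomPlanarGeometry.SAW.HexBW.Arm

variable {y : ℝ} {H N : ℕ}

/-! ### Walks of the slab started in the column `0` are `C`-class walks -/

/-- The column-`0` count of a placed walk equals the wall-visit count of any walk with the same columns.
[cite: Beaton2014RotatedHoneycomb, §3.2, Proposition 8 (arXiv v3 p. 15: vertices in the boundary)] -/
theorem leftVisits_eq_visits_of {a : Site 2} {υ ζ : ℕ → Site 2} (h : ∀ i, (a + υ i) 0 = ζ i 0) (m : ℕ) :
    leftVisits a υ m = visits m ζ := by
  induction m with
  | zero => rw [leftVisits, Finset.sum_range_one, visits_zero, h 0]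
  | succ m ih => rw [leftVisits, Finset.sum_range_succ, visits_succ, ← ih, leftVisits, h (m + 1)]

/-- A walk of `Slab_H` started at a cross-section site of the column `0`, re-based at `0` with the parity twist, is a `C`-class walk
with the same wall visits. [cite: Beaton2014RotatedHoneycomb, §3.2, Proposition 9 (arXiv v3 p. 15: walks of the strip are walks of the half-plane); EntingJensen2009, §7.4.2, Fig. 7.10] -/
theorem twist_mem_hp {m : ℕ} {p : Site 2 × (ℕ → Site 2)} (hpm : p ∈ slabPairs H m) (h0 : p.1 0 = 0) :
    (fun i => twistAt p.1 (p.2 i)) ∈ hp m ∧ visits m (fun i => twistAt p.1 (p.2 i)) = leftVisits p.1 p.2 m := by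
  obtain ⟨-, hυ, hbw, hsl⟩ := mem_slabPairs.1 hpm
  have hs : (fun i => twistAt p.1 (p.2 i)) ∈ saws m := by
    refine mem_saws.2 ⟨twistAt_comp_mem_zdSaws p.1 hυ, fun i hi => ?_⟩
    have key := hbw i hi
    rw [← adj_add_twistAt_iff p.1, twistAt_twistAt, twistAt_twistAt]
    exact key
  have hcol : ∀ i, (p.1 + p.2 i) 0 = twistAt p.1 (p.2 i) 0 := fun i => by
    rw [Pi.add_apply, h0, zero_add, twistAt_apply_zero]
  refine ⟨mem_hp.2 ⟨hs, fun i hi => ?_⟩, (leftVisits_eq_visits_of hcol m).symm⟩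
  show 0 ≤ twistAt p.1 (p.2 i) 0
  rw [← hcol i]; exact (hsl i hi).1

/-- The cross-section sites of the column `0` are `(0,0)` and `(0,1)`. [cite: MadrasSlade1993, §8.2, eq. (8.2.1)] -/
theorem card_wallStarts_le (H : ℕ) : #((slabStarts H).filter fun a => a 0 = 0) ≤ 2 := by
  classical
  have hsub : (slabStarts H).filter (fun a => a 0 = 0) ⊆ {pt 0 0, pt 0 1} := by
    intro a ha
    obtain ⟨ha, h0⟩ := Finset.mem_filter.1 ha
    obtain ⟨-, h1, h2⟩ := mem_slabStarts.1 ha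
    rw [Finset.mem_insert, Finset.mem_singleton, site_two_eq_iff, site_two_eq_iff]
    simp only [pt_apply_zero, pt_apply_one]
    omega
  exact (Finset.card_le_card hsub).trans (Finset.card_le_two)

/-- **`Σ_{walks of Slab_H with m steps started in the column 0} y^{visits} ≤ 2 C^w_m(y)`.**
[cite: Beaton2014RotatedHoneycomb, §3.2, Proposition 9 (arXiv v3 p. 15); BeatonBousquetMelouDeGierDuminilCopinGuttmann2014, proof of Proposition 7] -/
theorem sum_wallStart_le (H m : ℕ) (hy : 0 < y) :
    ∑ p ∈ (slabPairs H m).filter (fun p => p.1 0 = 0), y ^ leftVisits p.1 p.2 m ≤ 2 * Cw m y := by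
  classical
  set W := (slabPairs H m).filter (fun p : Site 2 × (ℕ → Site 2) => p.1 0 = 0) with hW
  set F : Site 2 × (ℕ → Site 2) → Site 2 × (ℕ → Site 2) := fun p => (p.1, fun i => twistAt p.1 (p.2 i)) with hF
  have hinj : Set.InjOn F ↑W := by
    rintro ⟨a, ω⟩ - ⟨a', ω'⟩ - h
    simp only [hF, Prod.mk.injEq] at h ⊢
    obtain ⟨rfl, h2⟩ := h
    exact ⟨rfl, funext fun i => twistAt_injective a (congrFun h2 i)⟩
  have hmaps : ∀ p ∈ W, F p ∈ ((slabStarts H).filter fun a => a 0 = 0) ×ˢ hp m := fun p hpW => by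
    obtain ⟨hpS, h0⟩ := Finset.mem_filter.1 hpW
    exact Finset.mem_product.2 ⟨Finset.mem_filter.2 ⟨(mem_slabPairs.1 hpS).1, h0⟩, (twist_mem_hp hpS h0).1⟩
  calc ∑ p ∈ W, y ^ leftVisits p.1 p.2 m = ∑ p ∈ W, y ^ visits m (F p).2 := by
        refine Finset.sum_congr rfl fun p hpW => ?_
        obtain ⟨hpS, h0⟩ := Finset.mem_filter.1 hpW
        show y ^ leftVisits p.1 p.2 m = y ^ visits m (fun i => twistAt p.1 (p.2 i))
        rw [(twist_mem_hp hpS h0).2]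
    _ = ∑ q ∈ W.image F, y ^ visits m q.2 := (Finset.sum_image (f := fun q => y ^ visits m q.2) hinj).symm
    _ ≤ ∑ q ∈ ((slabStarts H).filter fun a => a 0 = 0) ×ˢ hp m, y ^ visits m q.2 :=
        Finset.sum_le_sum_of_subset_of_nonneg (fun q hq => by
          obtain ⟨p, hpW, rfl⟩ := Finset.mem_image.1 hq; exact hmaps p hpW) fun _ _ _ => pow_nonneg hy.le _
    _ = ∑ a ∈ ((slabStarts H).filter fun a => a 0 = 0), Cw m y := by rw [Finset.sum_product]; rfl
    _ = #((slabStarts H).filter fun a => a 0 = 0) * Cw m y := by rw [Finset.sum_const, nsmul_eq_mul]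
    _ ≤ 2 * Cw m y := by
        have := card_wallStarts_le H
        exact mul_le_mul_of_nonneg_right (by exact_mod_cast this) (Cw_nonneg m hy.le)

/-! ### The first-visit split -/

open Classical in
/-- The first column-`0` time of the placed walk (`N + 1` if there is none). [cite: BeatonBousquetMelouDeGierDuminilCopinGuttmann2014, proof of Proposition 7 (decomposition at a surface contact)] -/
def fvisit (N : ℕ) (p : Site 2 × (ℕ → Site 2)) : ℕ :=
  if h : ∃ i, i ≤ N ∧ (p.1 + p.2 i) 0 = 0 then Nat.find h else N + 1

/-- `fvisit ≤ N + 1`. [cite: BeatonBousquetMelouDeGierDuminilCopinGuttmann2014, proof of Proposition 7] -/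
theorem fvisit_le (N : ℕ) (p : Site 2 × (ℕ → Site 2)) : fvisit N p ≤ N + 1 := by
  unfold fvisit
  split_ifs with h
  · obtain ⟨hi, -⟩ := Nat.find_spec h; omega
  · exact le_rfl

/-- If `fvisit = N+1` there is no column-`0` vertex. [cite: BeatonBousquetMelouDeGierDuminilCopinGuttmann2014, proof of Proposition 7] -/
theorem no_visit_of_fvisit_eq {p : Site 2 × (ℕ → Site 2)} (h : fvisit N p = N + 1) {i : ℕ} (hi : i ≤ N) : (p.1 + p.2 i) 0 ≠ 0 := by
  intro h0
  unfold fvisit at h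
  split_ifs at h with hex
  · have := Nat.find_min' hex ⟨hi, h0⟩; omega
  · exact hex ⟨i, hi, h0⟩

/-- If `fvisit = k ≤ N` then time `k` is a visit and there is none before. [cite: BeatonBousquetMelouDeGierDuminilCopinGuttmann2014, proof of Proposition 7] -/
theorem fvisit_spec {p : Site 2 × (ℕ → Site 2)} {k : ℕ} (h : fvisit N p = k) (hk : k ≤ N) :
    (p.1 + p.2 k) 0 = 0 ∧ ∀ j < k, (p.1 + p.2 j) 0 ≠ 0 := by
  unfold fvisit at h
  split_ifs at h with hex
  · subst h
    exact ⟨(Nat.find_spec hex).2, fun j hj h0 => Nat.find_min hex hj ⟨by have := (Nat.find_spec hex).1; omega, h0⟩⟩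
  · omega

/-- No visit ⇒ the weight is `1`. [cite: Beaton2014RotatedHoneycomb, §3.2, Proposition 8 (arXiv v3 p. 15)] -/
theorem leftVisits_eq_zero_of {a : Site 2} {υ : ℕ → Site 2} (h : ∀ i ≤ N, (a + υ i) 0 ≠ 0) : leftVisits a υ N = 0 := by
  unfold leftVisits
  refine Finset.sum_eq_zero fun m hm => ?_
  rw [if_neg (h m (Nat.lt_succ_iff.1 (Finset.mem_range.1 hm)))]

/-- The prefix up to the first visit carries exactly one visit. [cite: Beaton2014RotatedHoneycomb, §3.2, Proposition 8 (arXiv v3 p. 15)] -/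
theorem leftVisits_prefix_eq_one {a : Site 2} {υ : ℕ → Site 2} {k : ℕ} (hk0 : (a + υ k) 0 = 0) (hlt : ∀ j < k, (a + υ j) 0 ≠ 0) :
    leftVisits a (fun i => υ (min i k)) k = 1 := by
  unfold leftVisits
  rw [Finset.sum_range_succ]
  have h1 : (if (a + (fun i => υ (min i k)) k) 0 = 0 then 1 else 0) = 1 := by
    simp only [min_self]; rw [if_pos hk0]
  have h2 : ∑ m ∈ range k, (if (a + (fun i => υ (min i k)) m) 0 = 0 then 1 else 0) = 0 :=
    Finset.sum_eq_zero fun m hm => by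
      have hm : m < k := Finset.mem_range.1 hm
      simp only [min_eq_left hm.le]; rw [if_neg (hlt m hm)]
  rw [h1, h2]

/-- **The first-visit split**: `Ĉ_{H,N}(y) ≤ c_N(Slab_H) + Σ_{k ≤ N} c_k(Slab_H) · 2 C^w_{N−k}(y)`.
[cite: Beaton2014RotatedHoneycomb, §3.2, Proposition 9 (arXiv v3 p. 15: μ_T(1,y) ≤ μ(y)); BeatonBousquetMelouDeGierDuminilCopinGuttmann2014, proof of Proposition 7] -/
theorem slabZ_le_sum (H N : ℕ) (hy : 0 < y) :
    slabZ H N y ≤ slabCount H N + ∑ k ∈ range (N + 1), (slabCount H k : ℝ) * (2 * Cw (N - k) y) := by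
  classical
  set S := slabPairs H N with hS
  have hmaps : ∀ p ∈ S, fvisit N p ∈ range (N + 2) := fun p _ => Finset.mem_range.2 (by have := fvisit_le N p; omega)
  have hsplit : slabZ H N y = ∑ k ∈ range (N + 2), ∑ p ∈ S.filter (fun p => fvisit N p = k), y ^ leftVisits p.1 p.2 N := by
    rw [slabZ, ← hS, Finset.sum_fiberwise_of_maps_to hmaps]
  -- the fibre without visits
  have hnone : ∑ p ∈ S.filter (fun p => fvisit N p = N + 1), y ^ leftVisits p.1 p.2 N ≤ slabCount H N := by
    calc ∑ p ∈ S.filter (fun p => fvisit N p = N + 1), y ^ leftVisits p.1 p.2 N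
        = ∑ p ∈ S.filter (fun p => fvisit N p = N + 1), (1 : ℝ) := by
          refine Finset.sum_congr rfl fun p hp => ?_
          obtain ⟨-, hf⟩ := Finset.mem_filter.1 hp
          rw [leftVisits_eq_zero_of fun i hi => no_visit_of_fvisit_eq hf hi, pow_zero]
      _ = #(S.filter (fun p => fvisit N p = N + 1)) := by rw [Finset.sum_const, nsmul_eq_mul, mul_one]
      _ ≤ slabCount H N := by rw [slabCount, ← hS]; exact_mod_cast Finset.card_filter_le _ _
  -- the fibres with a first visit at k ≤ N
  have hfib : ∀ k ≤ N, ∑ p ∈ S.filter (fun p => fvisit N p = k), y ^ leftVisits p.1 p.2 N ≤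
      (slabCount H k : ℝ) * (2 * Cw (N - k) y) := by
    intro k hk
    have hNk : k + (N - k) = N := Nat.add_sub_cancel' hk
    set Sk := S.filter (fun p => fvisit N p = k) with hSk
    set W := (slabPairs H (N - k)).filter (fun p : Site 2 × (ℕ → Site 2) => p.1 0 = 0) with hW
    have hSk_sub : Sk ⊆ slabPairs H (k + (N - k)) := fun p hp => by rw [hNk]; exact (Finset.mem_filter.1 hp).1
    have hinj : Set.InjOn (slabSplit k (N - k)) ↑Sk := (slabSplit_injOn H k (N - k)).mono (by exact_mod_cast hSk_sub)
    have hmaps : ∀ p ∈ Sk, slabSplit k (N - k) p ∈ slabPairs H k ×ˢ W := fun p hp => by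
      obtain ⟨hpS, hf⟩ := Finset.mem_filter.1 hp
      have hm := slabSplit_mem (hSk_sub hp)
      rw [Finset.mem_product] at hm ⊢
      refine ⟨hm.1, Finset.mem_filter.2 ⟨hm.2, ?_⟩⟩
      show (vnorm (p.1 + p.2 k)) 0 = 0
      rw [vnorm_apply_zero]; exact (fvisit_spec hf hk).1
    have hwt : ∀ p ∈ Sk, y ^ leftVisits p.1 p.2 N = y ^ leftVisits (slabSplit k (N - k) p).2.1 (slabSplit k (N - k) p).2.2 (N - k) :=
      fun p hp => by
      obtain ⟨hpS, hf⟩ := Finset.mem_filter.1 hp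
      obtain ⟨hk0, hlt⟩ := fvisit_spec hf hk
      have hs := leftVisits_split p.1 p.2 k (N - k)
      rw [hNk, if_pos hk0] at hs
      have h1 : leftVisits (slabSplit k (N - k) (p.1, p.2)).1.1 (slabSplit k (N - k) (p.1, p.2)).1.2 k = 1 :=
        leftVisits_prefix_eq_one hk0 hlt
      rw [h1] at hs
      congr 1
      have : leftVisits p.1 p.2 N = leftVisits (slabSplit k (N - k) (p.1, p.2)).2.1 (slabSplit k (N - k) (p.1, p.2)).2.2 (N - k) := by
        omega
      exact this
    calc ∑ p ∈ Sk, y ^ leftVisits p.1 p.2 N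
        = ∑ p ∈ Sk, y ^ leftVisits (slabSplit k (N - k) p).2.1 (slabSplit k (N - k) p).2.2 (N - k) := Finset.sum_congr rfl hwt
      _ = ∑ q ∈ Sk.image (slabSplit k (N - k)), y ^ leftVisits q.2.1 q.2.2 (N - k) :=
          (Finset.sum_image (f := fun q : (Site 2 × (ℕ → Site 2)) × (Site 2 × (ℕ → Site 2)) =>
            y ^ leftVisits q.2.1 q.2.2 (N - k)) hinj).symm
      _ ≤ ∑ q ∈ slabPairs H k ×ˢ W, y ^ leftVisits q.2.1 q.2.2 (N - k) :=
          Finset.sum_le_sum_of_subset_of_nonneg (fun q hq => by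
            obtain ⟨p, hp, rfl⟩ := Finset.mem_image.1 hq; exact hmaps p hp) fun _ _ _ => pow_nonneg hy.le _
      _ = ∑ P ∈ slabPairs H k, ∑ q ∈ W, y ^ leftVisits q.1 q.2 (N - k) := by rw [Finset.sum_product]
      _ = (slabCount H k : ℝ) * ∑ q ∈ W, y ^ leftVisits q.1 q.2 (N - k) := by
          rw [Finset.sum_const, nsmul_eq_mul, slabCount]
      _ ≤ (slabCount H k : ℝ) * (2 * Cw (N - k) y) :=
          mul_le_mul_of_nonneg_left (sum_wallStart_le H (N - k) hy) (Nat.cast_nonneg _)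
  rw [hsplit, Finset.sum_range_succ]
  rw [add_comm]
  exact add_le_add hnone (Finset.sum_le_sum fun k hk => hfib k (Nat.lt_succ_iff.1 (Finset.mem_range.1 hk)))

/-! ### The upper bound on the strip growth rate -/

/-- **`Ĉ_{H,N}(y) ≤ K (N+1)² r^N`** for `r > max(β_rot(y), μ)`, given the face. [cite: Beaton2014RotatedHoneycomb, §3.2, Proposition 9 (arXiv v3 p. 15); BeatonBousquetMelouDeGierDuminilCopinGuttmann2014, proof of Proposition 7] -/
theorem slabZ_le_mul_pow (hy : 0 < y) (hA : ArchBound y) {r : ℝ} (hr : max (armRate y) hexConnectiveConstant < r) (H : ℕ) :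
    ∃ K : ℝ, 0 ≤ K ∧ ∀ N : ℕ, slabZ H N y ≤ K * ((N : ℝ) + 1) ^ 2 * r ^ N := by
  obtain ⟨hβr, hμr⟩ := max_lt_iff.1 hr
  have hr0 : 0 < r := (armRate_pos y).trans hβr
  obtain ⟨C₁, hC₁⟩ := Cw_le_of_archBound hy hA hr
  obtain ⟨C₂, hC₂0, hC₂⟩ := exists_hexSawCount_le_pow hμr
  have hC₁0 : 0 ≤ C₁ := by
    have := (Cw_nonneg 0 hy.le).trans (hC₁ 0)
    simpa using this
  have hsc : ∀ k : ℕ, (slabCount H k : ℝ) ≤ 2 * ((H : ℝ) + 1) * (C₂ * r ^ k) := fun k => by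
    calc (slabCount H k : ℝ) ≤ ((2 * (H + 1) * hexSawCount k : ℕ) : ℝ) := by exact_mod_cast slabCount_le H k
      _ = 2 * ((H : ℝ) + 1) * hexSawCount k := by push_cast; ring
      _ ≤ 2 * ((H : ℝ) + 1) * (C₂ * r ^ k) := mul_le_mul_of_nonneg_left (hC₂ k) (by positivity)
  refine ⟨2 * ((H : ℝ) + 1) * C₂ * (1 + 2 * C₁), by positivity, fun N => ?_⟩
  have hterm : ∀ k ∈ range (N + 1), (slabCount H k : ℝ) * (2 * Cw (N - k) y) ≤
      2 * ((H : ℝ) + 1) * C₂ * (2 * C₁) * ((N : ℝ) + 1) * r ^ N := by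
    intro k hk
    have hkN : k ≤ N := Nat.lt_succ_iff.1 (Finset.mem_range.1 hk)
    have hCw := hC₁ (N - k)
    have hNk : ((N - k : ℕ) : ℝ) + 1 ≤ (N : ℝ) + 1 := by
      have : ((N - k : ℕ) : ℝ) ≤ N := by exact_mod_cast Nat.sub_le N k
      linarith
    have hpow : r ^ k * r ^ (N - k) = r ^ N := by rw [← pow_add, Nat.add_sub_cancel' hkN]
    calc (slabCount H k : ℝ) * (2 * Cw (N - k) y)
        ≤ (2 * ((H : ℝ) + 1) * (C₂ * r ^ k)) * (2 * (C₁ * (((N - k : ℕ) : ℝ) + 1) * r ^ (N - k))) :=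
          mul_le_mul (hsc k) (by linarith) (by have := Cw_nonneg (N - k) hy.le; linarith) (by positivity)
      _ ≤ (2 * ((H : ℝ) + 1) * (C₂ * r ^ k)) * (2 * (C₁ * ((N : ℝ) + 1) * r ^ (N - k))) := by
          gcongr
      _ = 2 * ((H : ℝ) + 1) * C₂ * (2 * C₁) * ((N : ℝ) + 1) * (r ^ k * r ^ (N - k)) := by ring
      _ = _ := by rw [hpow]
  calc slabZ H N y ≤ slabCount H N + ∑ k ∈ range (N + 1), (slabCount H k : ℝ) * (2 * Cw (N - k) y) := slabZ_le_sum H N hy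
    _ ≤ 2 * ((H : ℝ) + 1) * (C₂ * r ^ N) + ∑ k ∈ range (N + 1), 2 * ((H : ℝ) + 1) * C₂ * (2 * C₁) * ((N : ℝ) + 1) * r ^ N :=
        add_le_add (hsc N) (Finset.sum_le_sum hterm)
    _ = 2 * ((H : ℝ) + 1) * C₂ * r ^ N * (1 + 2 * C₁ * ((N : ℝ) + 1) ^ 2) := by
        rw [Finset.sum_const, Finset.card_range, nsmul_eq_mul]; push_cast; ring
    _ ≤ 2 * ((H : ℝ) + 1) * C₂ * r ^ N * ((1 + 2 * C₁) * ((N : ℝ) + 1) ^ 2) := by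
        refine mul_le_mul_of_nonneg_left ?_ (by positivity)
        have h1 : (1 : ℝ) ≤ ((N : ℝ) + 1) ^ 2 := by nlinarith [Nat.cast_nonneg (α := ℝ) N]
        nlinarith [h1, hC₁0, sq_nonneg ((N : ℝ) + 1)]
    _ = 2 * ((H : ℝ) + 1) * C₂ * (1 + 2 * C₁) * ((N : ℝ) + 1) ^ 2 * r ^ N := by ring

/-- **`μ_H(y) ≤ max(β_rot(y), μ)`** (`H ≥ 1`, `y > 0`), given the face «ARM-ARCH-BOUND».
[cite: Beaton2014RotatedHoneycomb, §3.2, Proposition 9 (arXiv v3 p. 15: μ_T(1,y) → μ(y), the easy half μ_T ≤ μ(y)); BeatonBousquetMelouDeGierDuminilCopinGuttmann2014, proof of Proposition 7] -/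
theorem slabMuY_le_of_archBound (hy : 0 < y) (hA : ArchBound y) (hH : 1 ≤ H) :
    slabMuY H y ≤ max (armRate y) hexConnectiveConstant := by
  refine le_of_forall_gt_imp_ge_of_dense fun r' hr' => ?_
  obtain ⟨r, hr, hrr'⟩ := exists_between hr'
  have hr0 : 0 < r := (armRate_pos y).trans_le ((le_max_left _ _).trans hr.le)
  have hr'0 : 0 < r' := hr0.trans hrr'
  obtain ⟨K, hK0, hK⟩ := slabZ_le_mul_pow hy hA hr H
  have hyK : 0 < yK y := lt_of_lt_of_le zero_lt_one (one_le_yK y)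
  -- eventually yK · K (N+1)² (r/r')^N < 1, so yK · Ĉ_{H,N} ≤ r'^N
  have ha1 : r / r' < 1 := (div_lt_one hr'0).2 hrr'
  have hev : ∀ᶠ N : ℕ in atTop, yK y * K * ((N : ℝ) + 1) ^ 2 * (r / r') ^ N < 1 := by
    have ha0 : 0 < r / r' := div_pos hr0 hr'0
    have t := tendsto_pow_const_mul_const_pow_of_lt_one 2 ha0.le ha1
    have t2 : Tendsto (fun N : ℕ => (((N + 1 : ℕ) : ℝ)) ^ 2 * (r / r') ^ (N + 1)) atTop (𝓝 0) :=
      t.comp (tendsto_add_atTop_nat 1)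
    have t' : Tendsto (fun N : ℕ => yK y * K * ((N : ℝ) + 1) ^ 2 * (r / r') ^ N) atTop (𝓝 0) := by
      have t3 := t2.const_mul (yK y * K * (r / r')⁻¹)
      rw [mul_zero] at t3
      refine t3.congr fun N => ?_
      have hane : r / r' ≠ 0 := ha0.ne'
      show yK y * K * (r / r')⁻¹ * ((((N + 1 : ℕ) : ℝ)) ^ 2 * (r / r') ^ (N + 1)) = yK y * K * ((N : ℝ) + 1) ^ 2 * (r / r') ^ N
      rw [pow_succ, Nat.cast_add, Nat.cast_one]
      calc yK y * K * (r / r')⁻¹ * (((N : ℝ) + 1) ^ 2 * ((r / r') ^ N * (r / r')))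
          = yK y * K * ((N : ℝ) + 1) ^ 2 * (r / r') ^ N * ((r / r')⁻¹ * (r / r')) := by ring
        _ = yK y * K * ((N : ℝ) + 1) ^ 2 * (r / r') ^ N := by rw [inv_mul_cancel₀ hane, mul_one]
    exact t'.eventually (gt_mem_nhds zero_lt_one)
  obtain ⟨N, hN, hN1⟩ := (hev.and (Filter.eventually_ge_atTop 1)).exists
  have hZ : yK y * slabZ H N y ≤ r' ^ N := by
    have hid : yK y * (K * ((N : ℝ) + 1) ^ 2 * r ^ N) = (yK y * K * ((N : ℝ) + 1) ^ 2 * (r / r') ^ N) * r' ^ N := by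
      rw [div_pow]; field_simp
    calc yK y * slabZ H N y ≤ yK y * (K * ((N : ℝ) + 1) ^ 2 * r ^ N) := mul_le_mul_of_nonneg_left (hK N) hyK.le
      _ = (yK y * K * ((N : ℝ) + 1) ^ 2 * (r / r') ^ N) * r' ^ N := hid
      _ ≤ 1 * r' ^ N := mul_le_mul_of_nonneg_right hN.le (pow_nonneg hr'0.le _)
      _ = r' ^ N := one_mul _
  calc slabMuY H y ≤ (yK y * slabZ H N y) ^ (1 / (N : ℝ)) := slabMuY_le_rpow hH hy (by omega)
    _ ≤ (r' ^ N) ^ (1 / (N : ℝ)) :=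
        Real.rpow_le_rpow (mul_nonneg hyK.le (slabZ_pos hH N hy).le) hZ (by positivity)
    _ = r' := by rw [one_div, Real.pow_rpow_inv_natCast hr'0.le (by omega)]

/-- **Beaton 2014, Proposition 9, second sentence, for every `y > 0`** (modulo the face and `μ ≤ β_rot(y)`, both discharged in the
lane: `HexSAWArmchairUnfolding.lean`, `HexSAWArmchairWallBridgeRate.lean`): **`μ_H(y) → β_rot(y)`** as `H → ∞`.
[cite: Beaton2014RotatedHoneycomb, §3.2, Proposition 9 (arXiv v3 p. 15: "as T → ∞, μ_T(1,y) → μ(y)")] -/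
theorem tendsto_slabMuY_of_archBound (hy : 0 < y) (hA : ArchBound y) (hμ : hexConnectiveConstant ≤ armRate y) :
    Tendsto (fun H : ℕ => slabMuY H y) atTop (𝓝 (armRate y)) := by
  have hmax : max (armRate y) hexConnectiveConstant = armRate y := max_eq_left hμ
  rw [tendsto_order]
  refine ⟨fun r hr => ?_, fun r hr => ?_⟩
  · obtain ⟨r₁, h1, h2⟩ := exists_between hr
    filter_upwards [eventually_le_slabMuY hy h2] with H hH
    exact h1.trans_le hH
  · filter_upwards [Filter.eventually_ge_atTop 1] with H hH
    exact (slabMuY_le_of_archBound hy hA hH).trans_lt (by rw [hmax]; exact hr)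

end Literature.Probability.RandomPlanarGeometry.SAW.HexBW.Arm
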